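import Summits.AnomalousDissipation.AnomalousDissipation.Theses.TwoAndHalfD
import Literature.Analysis.FluidPDE.GaussianVortexPlanar

/-!
# Sketch (crux-ideate, round 1, ideator 2) — first lemmas for three crux idea cards on
`ScalarAnomalySteadySourceFormal` (item stmt-AnomalousDissipation-0448, route TwoAndHalfD)

Typed statements only (no proofs required at this stage; every `def … : Prop` must elaborate).

* Card `odd-point-reflection-sector`: `IsPointOdd`, `IsPointEven`, `PointOddVelocityPropagation`,
  `PointOddScalarExistence`, `OddOrthogonalEven`, `OddZeroMeanOnSymmetricSets`,
  `PointOddWitness`, `pointOddWitness_transfer` (proved: forgetful).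
* Card `roving-neutral-cluster`: `dilateVort`, `BiotSavartDilationCovariance`,
  `NeutralClusterEnergyInvariance`, `EnstrophyDilationScaling`.
* Card `lp-flux-locality-threshold`: `IsBandLimited`, `VarianceFloorLipschitz`,
  `HasUniformScalarDissipationTime`, `DissipationTimeBoundsVariance`.
-/

set_option linter.dupNamespace false

noncomputable section

open MeasureTheory Filter Set
open scoped ENNReal

namespace Summit.AnomalousDissipation.AnomalousDissipation.Cruxes.ScalarAnomalySteadySourceFormal.SketchIdeator2

/-- The flat two-torus (local notation). -/
local notation "𝕋²" => UnitAddTorus (Fin 2)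
/-- Planar velocity values (local notation). -/
local notation "E²" => EuclideanSpace ℝ (Fin 2)

/-! ## Card 1 — odd point-reflection sector

The point reflection `x ↦ -x` of `T² = (ℝ/ℤ)²` (a Haar-preserving group automorphism with the four
fixed points `(0,0), (½,0), (0,½), (½,½)`) acts on velocity fields by push-forward
`(P⋆v)(x) = -v(-x)` and on scalars by `θ ↦ θ ∘ P`. The NS/advection–diffusion system is
`P`-covariant, so the sector {`v` odd, `θ` odd} is exactly invariant when `g` and `h` are odd. In
this sector the stream function, the vorticity and `curl g` are EVEN, hence `L²`-orthogonal to
`h` and to `θ(t)` for every `t`. -/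

/-- `f` is odd under the point reflection of `T²` (used for the force `g`, the velocities `v t`,
the source `h` and the scalars `θ t`: for vector fields this IS push-forward equivariance). -/
def IsPointOdd {F : Type*} [Neg F] (f : 𝕋² → F) : Prop := ∀ x, f (-x) = -f x

/-- `f` is even under the point reflection of `T²` (stream functions, vorticities, `curl g`). -/
def IsPointEven {F : Type*} (f : 𝕋² → F) : Prop := ∀ x, f (-x) = f x

/-- **First lemma 1a (sector propagation for the planar flow).** For an odd smooth steady force and
an odd `L²` datum, the (unique, Lions–Prodi) global Leray–Hopf solution is odd at every positive
time (a.e. in space). Proof route: `P`-covariance of `Torus.IsGlobalLerayHopf` + the tree theorem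
`lions_prodi_uniqueness_torus2_holds`. -/
def PointOddVelocityPropagation : Prop :=
  ∀ (ν : ℝ) (g v₀ : 𝕋² → E²) (v : ℝ → 𝕋² → E²), 0 < ν →
    Literature.Analysis.FunctionSpaces.Torus.IsSmooth g → IsPointOdd g →
    MemLp v₀ 2 volume → Literature.Analysis.FunctionSpaces.Torus.IsWeaklyDivFree v₀ → IsPointOdd v₀ →
    Literature.Analysis.FluidPDE.Torus.IsGlobalLerayHopf ν (fun _ => g) v₀ v →
    ∀ t, 0 < t → (fun x => v t (-x)) =ᵐ[volume] fun x => -(v t x)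

/-- **First lemma 1b (odd scalar sector).** Over a velocity that is odd at every positive time,
with odd smooth source and odd `L²` datum: if some global weak solution of the sourced
advection–diffusion equation exists, then an everywhere-odd one exists (antisymmetrise:
`θ̃ = (θ - θ ∘ P)/2` is again a weak solution by `P`-covariance and linearity). -/
def PointOddScalarExistence : Prop :=
  ∀ (κ : ℝ) (v : ℝ → 𝕋² → E²) (h θ₀ : 𝕋² → ℝ), 0 < κ →
    (∀ t, 0 < t → (fun x => v t (-x)) =ᵐ[volume] fun x => -(v t x)) →
    Literature.Analysis.FunctionSpaces.Torus.IsSmooth h → IsPointOdd h →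
    MemLp θ₀ 2 volume → IsPointOdd θ₀ →
    (∃ θ, Literature.Analysis.FluidPDE.Torus.IsWeakScalarTransportForced κ v (fun _ => h) θ₀ θ) →
    ∃ θ, Literature.Analysis.FluidPDE.Torus.IsWeakScalarTransportForced κ v (fun _ => h) θ₀ θ ∧
      ∀ t, IsPointOdd (θ t)

/-- **Bite 1c (sector orthogonality; provable now).** An odd and an even square-integrable
function on `T²` are `L²`-orthogonal (substitute `x ↦ -x`, which preserves Haar measure). Applied
to `θ(t)` (odd) against the vorticity, the stream function, `curl g`, and every `F(ψ̄)` of an even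
stream function `ψ̄` — the whole non-dissipating subspace of Johansson–Sorella Rem. 1.2 for an
equivariant autonomous limit field. -/
def OddOrthogonalEven : Prop :=
  ∀ (a b : 𝕋² → ℝ), IsPointOdd a → IsPointEven b → MemLp a 2 volume → MemLp b 2 volume →
    ∫ x, a x * b x = 0

/-- **Bite 1d (no accumulation mode on symmetric invariant sets; provable now).** An odd integrable
source has zero mean on every measurable set invariant under the point reflection — in particular
on every sublevel set `{ψ̄ < c}` / closed streamline annulus of an even stream function around a
fixed point, and on every symmetric vortex core: the `m = 0` (streamline-averaged) component of the
source that drives the `O(ν⁻²)` laminar / `O(ν^{-2/3})` enhanced-dissipation variance blow-up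
vanishes identically, uniformly in `ν` and without knowing the flow. -/
def OddZeroMeanOnSymmetricSets : Prop :=
  ∀ (h : 𝕋² → ℝ) (S : Set 𝕋²), Integrable h volume → IsPointOdd h → MeasurableSet S →
    (fun x : 𝕋² => -x) ⁻¹' S = S → ∫ x in S, h x = 0

/-- **Transfer target `C⁺` (the crux inside the odd sector).** Same data as the crux plus: `g`, `h`
odd; every `v_j t` (for `t > 0`, a.e.) and every `θ_j t` odd. -/
def PointOddWitness : Prop :=
  ∃ (g : 𝕋² → E²) (h : 𝕋² → ℝ), Literature.Analysis.FunctionSpaces.Torus.IsSmooth g ∧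
    Literature.Analysis.FunctionSpaces.Torus.IsDivFree g ∧ Literature.Analysis.FunctionSpaces.Torus.HasZeroMean g ∧
    Literature.Analysis.FunctionSpaces.Torus.IsSmooth h ∧ Literature.Analysis.FunctionSpaces.Torus.HasZeroMean h ∧
    IsPointOdd g ∧ IsPointOdd h ∧
    ∃ (ν : ℕ → ℝ) (v₀ : ℕ → 𝕋² → E²) (v : ℕ → ℝ → 𝕋² → E²) (θ₀ : ℕ → 𝕋² → ℝ) (θ : ℕ → ℝ → 𝕋² → ℝ),
      (∀ j, 0 < ν j) ∧ Tendsto ν atTop (nhds 0) ∧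
      (∀ j, Literature.Analysis.FluidPDE.Torus.IsGlobalLerayHopf (ν j) (fun _ => g) (v₀ j) (v j)) ∧
      (∀ j, MemLp (θ₀ j) 2 volume) ∧
      (∀ j, Literature.Analysis.FluidPDE.Torus.IsWeakScalarTransportForced (ν j) (v j) (fun _ => h) (θ₀ j) (θ j)) ∧
      (∀ j t, 0 < t → (fun x => v j t (-x)) =ᵐ[volume] fun x => -(v j t x)) ∧
      (∀ j t, IsPointOdd (θ j t)) ∧
      (∃ E : ℝ, ∀ j, Literature.Analysis.FluidPDE.meanEnergy (v j) ≤ E) ∧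
      (∃ E : ℝ, ∀ j, Literature.Analysis.FluidPDE.longTimeAvgSup
          (fun t => Literature.Analysis.FluidPDE.Torus.scalarL2Sq (θ j t)) ≤ E) ∧
      ∃ ε : ℝ, 0 < ε ∧ ∀ j, ε ≤ Literature.Analysis.FluidPDE.longTimeAvgSup
          (fun t => ν j * (Literature.Analysis.FluidPDE.Torus.eScalarGradNormSq (θ j t)).toReal)

/-- The transfer `C⁺ → crux` is forgetful (drop the four parity conjuncts). -/
theorem pointOddWitness_transfer :
    PointOddWitness → Summit.AnomalousDissipation.AnomalousDissipation.Theses.TwoAndHalfD.ScalarAnomalySteadySourceFormal := by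
  rintro ⟨g, h, hgs, hgd, hgm, hhs, hhm, -, -, ν, v₀, v, θ₀, θ, hν, hν0, hLH, hθ₀, hθ, -, -, hE, hV, hε⟩
  exact ⟨g, h, hgs, hgd, hgm, hhs, hhm, ν, v₀, v, θ₀, θ, hν, hν0, hLH, hθ₀, hθ, hE, hV, hε⟩

/-! ## Card 2 — roving neutral cluster (dilation-invariant energy of neutral vortex clusters)

Planar statements over `Literature.Analysis.FluidPDE.biotSavart2D` (`v = K_{2D} ∗ ω`). -/

/-- Planar vorticity values (local notation). -/
local notation "ℝ²" => EuclideanSpace ℝ (Fin 2)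

/-- Circulation-preserving dilation of a planar vorticity by the factor `lam > 0`:
`ω_λ(x) = λ⁻² ω(x/λ)` (so `∫ ω_λ = ∫ ω` and supports shrink by `λ`). -/
def dilateVort (lam : ℝ) (w : ℝ² → ℝ) (x : ℝ²) : ℝ := (lam ^ 2)⁻¹ * w (lam⁻¹ • x)

/-- **First lemma 2a (Biot–Savart is dilation covariant; provable now by the change of variables
`y ↦ λy`).** `K ∗ ω_λ (x) = λ⁻¹ (K ∗ ω)(x/λ)`. -/
def BiotSavartDilationCovariance : Prop :=
  ∀ (lam : ℝ), 0 < lam → ∀ (w : ℝ² → ℝ) (x : ℝ²),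
    Literature.Analysis.FluidPDE.biotSavart2D (dilateVort lam w) x =
      lam⁻¹ • Literature.Analysis.FluidPDE.biotSavart2D w (lam⁻¹ • x)

/-- **First lemma 2b (kinetic energy of a planar vorticity configuration is invariant under
circulation-preserving dilation; provable now from 2a).** In `[0, ∞]`, so no integrability is
needed; the energy is finite exactly for NEUTRAL (`∫ ω = 0`) configurations with enough decay. -/
def NeutralClusterEnergyInvariance : Prop :=
  ∀ (lam : ℝ), 0 < lam → ∀ (w : ℝ² → ℝ),
    ∫⁻ x, ‖Literature.Analysis.FluidPDE.biotSavart2D (dilateVort lam w) x‖ₑ ^ 2 =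
      ∫⁻ x, ‖Literature.Analysis.FluidPDE.biotSavart2D w x‖ₑ ^ 2

/-- **First lemma 2c (enstrophy blows up like `λ⁻²` under the same dilation; provable now).**
Together with 2b: shrinking a neutral cluster costs no energy while enstrophy, internal strain
(`∝ Γ/d²`) and self-propulsion speed (`∝ Γ/d`) grow without bound. -/
def EnstrophyDilationScaling : Prop :=
  ∀ (lam : ℝ), 0 < lam → ∀ (w : ℝ² → ℝ),
    ∫⁻ x, ‖dilateVort lam w x‖ₑ ^ 2 = ENNReal.ofReal ((lam ^ 2)⁻¹) * ∫⁻ x, ‖w x‖ₑ ^ 2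

/-! ## Card 3 — Littlewood–Paley flux locality: the variance floor and the mixing-rate transfer -/

/-- `h` has Fourier support in the ball `|k| ≤ K` (band-limited smooth source). -/
def IsBandLimited (K : ℝ) (h : 𝕋² → ℝ) : Prop :=
  ∀ k : Fin 2 → ℤ, K < ‖(fun i => (k i : ℝ))‖ → UnitAddTorus.mFourierCoeff (fun x => (h x : ℂ)) k = 0

/-- **First lemma 3a (variance floor in uniformly Lipschitz stirring; the stationary-sourced
Batchelor logarithm).** There is an absolute `c > 0` such that for every divergence-free velocity
with `sup_t Lip(v(t)) ≤ Λ`, every band-limited (`|k| ≤ K`) smooth mean-zero steady source and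
every global weak solution of `∂ₜθ + v·∇θ = κΔθ + h` with limsup-mean variance `V > 0` and
limsup-mean dissipation (= flux) `χ > 0`:  `c χ log(χ/(κ V K²)) ≤ Λ V + C χ` (the additive `Cχ` absorbs
the `8π²` of the dissipation symbol and the two edge shells; heat/drift test `v = const`: `χ = 4π²κK²V`
exactly, both sides consistent).
Proof route: dyadic high-pass budgets `Π_i = Σ_{j ≥ i} D_j`, `Π_i = -⟨(v·∇θ_{<i}, θ_{≥i})⟩`
bounded by `C Λ ×` (geometrically weighted band variances) via the commutator/Bernstein
estimates for a Lipschitz field; `Σ_i Π_i ≤ C Λ V` against `Π_i ≥ χ/2` for the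
`½ log₂(χ/(2κVK²))` dyadic shells between `K` and `(χ/(2κV))^{1/2}`. -/
def VarianceFloorLipschitz : Prop :=
  ∃ c C : ℝ, 0 < c ∧ 0 ≤ C ∧ ∀ (κ Λ K : ℝ) (v : ℝ → 𝕋² → E²) (h θ₀ : 𝕋² → ℝ) (θ : ℝ → 𝕋² → ℝ),
    0 < κ → 0 < Λ → 1 ≤ K →
    (∀ t, LipschitzWith (Real.toNNReal Λ) (v t)) →
    (∀ t, Literature.Analysis.FunctionSpaces.Torus.IsWeaklyDivFree (v t)) →
    Literature.Analysis.FunctionSpaces.Torus.IsSmooth h → Literature.Analysis.FunctionSpaces.Torus.HasZeroMean h →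
    IsBandLimited K h → MemLp θ₀ 2 volume →
    Literature.Analysis.FluidPDE.Torus.IsWeakScalarTransportForced κ v (fun _ => h) θ₀ θ →
    ∀ (V χ : ℝ),
      V = Literature.Analysis.FluidPDE.longTimeAvgSup (fun t => Literature.Analysis.FluidPDE.Torus.scalarL2Sq (θ t)) →
      χ = Literature.Analysis.FluidPDE.longTimeAvgSup
            (fun t => κ * (Literature.Analysis.FluidPDE.Torus.eScalarGradNormSq (θ t)).toReal) →
      0 < V → 0 < χ →
      c * χ * Real.log (χ / (κ * V * K ^ 2)) ≤ Λ * V + C * χ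

/-- **Uniform scalar dissipation time** `τ` for the velocity `v` at diffusivity `κ`: every weak
solution of the UNFORCED equation started at any time `s ≥ 0` from any `L²` datum loses half of its
`L²` mass by time `τ` (the semigroup contracts by `1/2` on mean-zero data, uniformly in the
starting time). -/
def HasUniformScalarDissipationTime (κ τ : ℝ) (v : ℝ → 𝕋² → E²) : Prop :=
  ∀ (s : ℝ), 0 ≤ s → ∀ (φ₀ : 𝕋² → ℝ) (φ : ℝ → 𝕋² → ℝ), MemLp φ₀ 2 volume →
    Literature.Analysis.FunctionSpaces.Torus.HasZeroMean φ₀ →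
    Literature.Analysis.FluidPDE.Torus.IsWeakScalarTransportOn (2 * τ) κ (fun t => v (s + t)) φ₀ φ →
    ∀ᵐ t ∂(volume.restrict (Ioo τ (2 * τ))),
      Literature.Analysis.FluidPDE.Torus.scalarL2Sq (φ t) ≤ 2⁻¹ * Literature.Analysis.FluidPDE.Torus.scalarL2Sq φ₀

/-- **First lemma 3b (sufficiency half, standard Duhamel bookkeeping).** A uniform dissipation time
bounds the limsup-mean variance of the sourced problem by `C τ² ‖h‖²` (geometric series of
half-lives), whatever the datum. With 3a this makes the crux's variance clause two-sidedly
equivalent, up to constants, to super-logarithmic stirring: `τ_j = O(1)` needs a mixing rate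
`≳ log(1/ν_j)`, and 3a shows every witness has `Λ_j ≳ (ε/E) log(1/ν_j)`. -/
def DissipationTimeBoundsVariance : Prop :=
  ∃ C : ℝ, 0 < C ∧ ∀ (κ τ : ℝ) (v : ℝ → 𝕋² → E²) (h θ₀ : 𝕋² → ℝ) (θ : ℝ → 𝕋² → ℝ),
    0 < κ → 0 < τ → HasUniformScalarDissipationTime κ τ v →
    Literature.Analysis.FunctionSpaces.Torus.IsSmooth h → Literature.Analysis.FunctionSpaces.Torus.HasZeroMean h →
    MemLp θ₀ 2 volume → Literature.Analysis.FunctionSpaces.Torus.HasZeroMean θ₀ →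
    Literature.Analysis.FluidPDE.Torus.IsWeakScalarTransportForced κ v (fun _ => h) θ₀ θ →
    Literature.Analysis.FluidPDE.longTimeAvgSup (fun t => Literature.Analysis.FluidPDE.Torus.scalarL2Sq (θ t)) ≤
      C * τ ^ 2 * Literature.Analysis.FluidPDE.Torus.scalarL2Sq h

end Summit.AnomalousDissipation.AnomalousDissipation.Cruxes.ScalarAnomalySteadySourceFormal.SketchIdeator2

end
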